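import Literature.AlgebraicGeometry.Frobenioids.MotivatingExamplesSub
import Literature.IUT.LogVolume.PrincipalArithmeticDivisorsSpan
import HarnessLib

/-!
# [FrdI] Thm. 6.4 (i): the `δ_A`-isomorphism sub-nodes T64i/L13, T64i/L14, T64i/L15 (data level) — DISCHARGED

Mochizuki, *The geometry of Frobenioids I* (2008), Theorem 6.4 (i), last assertion (kurims p. 114; proof
p. 115 l. 27–33): "`δ_A : Pic_Φ(A) ⥲ ℝ`" — surjective "formally", injective "by the well-known Dirichlet
unit theorem". The cell's sub-DAG for Thm. 6.4 (abc-iut-L1-t1's `MotivatingExamplesSub.lean`) names the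
three data-level sub-statements `Thm64i_L13_degSurjective`, `Thm64i_L14_DirichletSpan`,
`Thm64i_L15_deltaIso_data`; this PROOF-ONLY file closes them by the theorems of
`Literature.IUT.LogVolume.PrincipalArithmeticDivisorsSpan` (`degF_surjective`,
`mem_span_APrc_of_degF_eq_zero`, `span_APrc_eq_ker_degF`). [cite: MochizukiFrdI2008, Thm. 6.4 (i) p.114]
-/

namespace Literature.AlgebraicGeometry.Frobenioids

open Literature.IUT.LogVolume

/-- **T64i/L13 DISCHARGED**: `deg_L : ADiv_ℝ(L) → ℝ` is surjective ([FrdI] Thm. 6.4 (i), proof p. 115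
l. 27–28). [cite: MochizukiFrdI2008, Thm. 6.4 (i) p.115] -/
theorem Thm64i_L13_degSurjective_holds :
    ∀ (L : Type) [Field L] [NumberField L], Thm64i_L13_degSurjective L :=
  fun L _ _ => degF_surjective L

/-- **T64i/L14 DISCHARGED** ("well-known Dirichlet unit theorem", [FrdI] Thm. 6.4 (i), proof p. 115
l. 28–32): every real arithmetic divisor of degree `0` on `L` is an `ℝ`-linear combination of principal
divisors. [cite: MochizukiFrdI2008, Thm. 6.4 (i) p.115] -/
theorem Thm64i_L14_DirichletSpan_holds :
    ∀ (L : Type) [Field L] [NumberField L], Thm64i_L14_DirichletSpan L :=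
  fun _ _ _ a ha => mem_span_APrc_of_degF_eq_zero a (LinearMap.mem_ker.mp ha)

/-- **T64i/L15 (data level) DISCHARGED**: `span_ℝ APrc(L) = Ker(deg_L)` and `deg_L` is onto, i.e. `deg_L`
induces `ADiv_ℝ(L)/span_ℝ APrc(L) ⥲ ℝ` ([FrdI] Thm. 6.4 (i) p. 114, "`δ_A : Pic_Φ(A) ⥲ ℝ`").
[cite: MochizukiFrdI2008, Thm. 6.4 (i) p.114] -/
theorem Thm64i_L15_deltaIso_data_holds :
    ∀ (L : Type) [Field L] [NumberField L], Thm64i_L15_deltaIso_data L :=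
  fun L _ _ => ⟨span_APrc_eq_ker_degF, degF_surjective L⟩

end Literature.AlgebraicGeometry.Frobenioids
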